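import Mathlib
import Literature.Analysis.FluidPDE.Tao2016AveragedNS.ViscousEternalSolutions
import HarnessLib

/-!
# Admissible eternal solutions are `C^∞` in log-time; births are infinitely flat; no analytic births
# (support / barrier lemmas for `WakeRatchet.AdmissibleEternalBound`, stmt-NavierStokesRegularity-23197)

MODEL lattice ODEs only (Tao 2016 §4, §6.4); nothing in this file is a statement about the
Navier–Stokes equations, and no summit or rung is proved by it.

Every shell `σ ↦ W_n(σ)` of an admissible eternal solution of the renormalised lattice of ANY table
(`IsEternalVisc ε₀ ν̂ α W`, any covariant viscosity `ν̂ ≥ 0`, no cancellation needed) is `C^∞`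
(`contDiff_of_isEternalVisc`): the law `W_n' = -W_n + Q(W_n) + Λ A(W_{n-1}) + Λ⁻¹ B(W_{n+1}, W_n) - ν̂(1+ε₀)^{2n}e^{-σ} W_n`
has a right-hand side that is polynomial in the three shells and smooth in `σ`, so `C^k` for all shells
bootstraps to `C^{k+1}` for all shells.  Consequences recorded here, aimed at CONSTRUCTIONS of admissible
solutions (the refutation side of the crux, which needs an explicit unbounded admissible solution):

* `iteratedDeriv_eq_zero_of_vanish_left` — if a shell vanishes on a left half-line `(-∞, σ₀]` («is born at
  `σ₀`»), then ALL its derivatives vanish at `σ₀`: births are infinitely flat.  Hence no admissible solution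
  can be assembled from pieces that are polynomial / rational / trigonometric / exponential up to a birth
  time with finite-order contact.
* `eventually_zero_of_analyticAt_birth` — a shell that is real-analytic at a birth time vanishes near it:
  half-line or compactly supported shells are never analytic at the edge of their support.
* `analytic_pieces_agree` — NO PIECEWISE-ANALYTIC GLUING: if a shell coincides with an analytic germ `g`
  just before `σ₀` and with an analytic germ `h` just after, then `g = h` near `σ₀`; a construction by
  stages with closed-form (analytic) pieces can never change formula at a stage boundary.

(Companion negative knowledge, not formalised here: rational-in-time shells with integrable tails are
impossible for the autonomous quadratic lattice — a power tail `t^{-k}`, `k ≥ 2`, of `V_n = e^{σ}W_n` is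
never matched by the quadratic right-hand side — and admissible DSS profiles have stretched-exponential
leading edges; see `Cruxes/AdmissibleEternalBound/PROVER-g5-analysis.md`.)
-/

noncomputable section

set_option linter.dupNamespace false

namespace Summit.NavierStokesRegularity.NavierStokesRegularity.Theorems

namespace WakeRatchetSmooth

open Filter Topology Set
open scoped ContDiff
open Literature.Analysis.FluidPDE Literature.Analysis.FluidPDE.TaoCascade

variable {m : ℕ} {ε₀ νh : ℝ} {α : Fin m → Fin m → Fin m → ℤ × ℤ × ℤ → ℝ} {W : ℤ → ℝ → Em m}

/-! ## The table maps are smooth (polynomial) -/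

/-- `Q` is smooth (a polynomial map). [cite: Tao2016AveragedNS, §4 (4.1), Lemma 4.1 (4.8)] -/
theorem contDiff_tableQ (α : Fin m → Fin m → Fin m → ℤ × ℤ × ℤ → ℝ) {k : WithTop ℕ∞} :
    ContDiff ℝ k (tableQ α) := by
  unfold tableQ qform; fun_prop

/-- `A` is smooth (a polynomial map). [cite: Tao2016AveragedNS, §4 (4.1), Lemma 4.1 (4.8)] -/
theorem contDiff_tableA (α : Fin m → Fin m → Fin m → ℤ × ℤ × ℤ → ℝ) {k : WithTop ℕ∞} :
    ContDiff ℝ k (tableA α) := by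
  unfold tableA qform; fun_prop

/-- `B` is jointly smooth (a polynomial map). [cite: Tao2016AveragedNS, §4 (4.1), Lemma 4.1 (4.8)] -/
theorem contDiff_tableB (α : Fin m → Fin m → Fin m → ℤ × ℤ × ℤ → ℝ) {k : WithTop ℕ∞} :
    ContDiff ℝ k (Function.uncurry (tableB α)) := by
  unfold tableB qform Function.uncurry; fun_prop

/-! ## Bootstrap: every shell of an admissible eternal solution is `C^∞` -/

/-- **`C^k` for every `k`.**  All shells of an admissible eternal solution (any table, any covariant
viscosity `ν̂ ≥ 0`) are `C^k` in log-time, for every `k : ℕ`.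
[cite: Tao2016AveragedNS, §4 Lemma 4.1 (iii) (4.8), §6.4; cell vocabulary (`IsEternalVisc`)] -/
theorem contDiff_nat_of_isEternalVisc (hW : IsEternalVisc ε₀ νh α W) :
    ∀ (k : ℕ) (n : ℤ), ContDiff ℝ k (W n) := by
  intro k
  induction k with
  | zero =>
      intro n
      exact contDiff_zero.2 (continuous_iff_continuousAt.2 fun σ => (hW.law n σ).continuousAt)
  | succ k ih =>
      intro n
      have hd : Differentiable ℝ (W n) := fun σ => (hW.law n σ).differentiableAt
      have hderiv : deriv (W n) = fun σ =>
          -((1 : ℝ) • W n σ) + tableQ α (W n σ) + bigLam ε₀ • tableA α (W (n - 1) σ)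
            + (bigLam ε₀)⁻¹ • tableB α (W (n + 1) σ) (W n σ)
            - (νh * ((1 + ε₀) ^ ((2 : ℝ) * n) * Real.exp (-σ))) • W n σ :=
        funext fun σ => (hW.law n σ).deriv
      rw [Nat.cast_succ, contDiff_succ_iff_deriv]
      refine ⟨hd, fun h => absurd h (by simp), ?_⟩
      rw [hderiv]
      have h0 : ContDiff ℝ k (W n) := ih n
      have h1 : ContDiff ℝ k (W (n - 1)) := ih (n - 1)
      have h2 : ContDiff ℝ k (W (n + 1)) := ih (n + 1)
      have hQ : ContDiff ℝ k (fun σ => tableQ α (W n σ)) := (contDiff_tableQ α).comp h0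
      have hA : ContDiff ℝ k (fun σ => tableA α (W (n - 1) σ)) := (contDiff_tableA α).comp h1
      have hB : ContDiff ℝ k (fun σ => tableB α (W (n + 1) σ) (W n σ)) :=
        (contDiff_tableB α).comp₂ h2 h0
      fun_prop

/-- **Smoothness.**  Every shell of an admissible eternal solution is `C^∞` in log-time.
[cite: Tao2016AveragedNS, §4 Lemma 4.1 (iii) (4.8), §6.4; cell vocabulary (`IsEternalVisc`)] -/
theorem contDiff_of_isEternalVisc (hW : IsEternalVisc ε₀ νh α W) (n : ℤ) :
    ContDiff ℝ ∞ (W n) :=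
  contDiff_infty.2 fun k => contDiff_nat_of_isEternalVisc hW k n

/-- The same for inviscid admissible solutions (`IsEternal`).
[cite: Tao2016AveragedNS, §4 Lemma 4.1 (iii) (4.8), §6.4; cell vocabulary (`IsEternal`)] -/
theorem contDiff_of_isEternal (hW : IsEternal ε₀ α W) (n : ℤ) : ContDiff ℝ ∞ (W n) :=
  contDiff_of_isEternalVisc hW.isEternalVisc n

/-! ## Births are infinitely flat -/

/-- A `C^∞` function vanishing on a left half-line `(-∞, σ₀]` has all derivatives zero at `σ₀`.
[folklore] -/
theorem iteratedDeriv_eq_zero_of_contDiff_of_vanish_left {f : ℝ → Em m} (hf : ContDiff ℝ ∞ f)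
    {σ₀ : ℝ} (h0 : ∀ σ, σ ≤ σ₀ → f σ = 0) (k : ℕ) : iteratedDeriv k f σ₀ = 0 := by
  have hcont : Continuous (iteratedDeriv k f) :=
    hf.continuous_iteratedDeriv k (by exact_mod_cast le_top)
  -- the derivative vanishes on the open half-line
  have hzero : ∀ σ, σ < σ₀ → iteratedDeriv k f σ = 0 := by
    intro σ hσ
    have hev : f =ᶠ[𝓝 σ] (fun _ => (0 : Em m)) := by
      filter_upwards [Iio_mem_nhds hσ] with s hs using h0 s (le_of_lt hs)
    rw [hev.iteratedDeriv_eq k, iteratedDeriv_const]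
    split_ifs <;> rfl
  -- and the zero set is closed
  have hclosed : IsClosed {σ : ℝ | iteratedDeriv k f σ = 0} := isClosed_eq hcont continuous_const
  have hsub : Iio σ₀ ⊆ {σ : ℝ | iteratedDeriv k f σ = 0} := fun σ hσ => hzero σ hσ
  have hcl : closure (Iio σ₀) ⊆ {σ : ℝ | iteratedDeriv k f σ = 0} :=
    hclosed.closure_subset_iff.2 hsub
  have hmem : σ₀ ∈ closure (Iio σ₀) := by rw [closure_Iio]; exact self_mem_Iic
  exact hcl hmem

/-- **Births are infinitely flat.**  If a shell of an admissible eternal solution (any table, any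
covariant viscosity) vanishes on a left half-line `(-∞, σ₀]`, then all its log-time derivatives vanish at
`σ₀`; in particular the shell cannot be continued across `σ₀` by a polynomial, rational, trigonometric or
exponential expression with finite-order contact.
[cite: Tao2016AveragedNS, §4 Lemma 4.1 (iii) (4.8), §6.4; cell vocabulary (`IsEternalVisc`)] -/
theorem iteratedDeriv_eq_zero_of_vanish_left (hW : IsEternalVisc ε₀ νh α W) {n : ℤ} {σ₀ : ℝ}
    (h0 : ∀ σ, σ ≤ σ₀ → W n σ = 0) (k : ℕ) : iteratedDeriv k (W n) σ₀ = 0 :=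
  iteratedDeriv_eq_zero_of_contDiff_of_vanish_left (contDiff_of_isEternalVisc hW n) h0 k

/-- The mirror statement: a shell vanishing on a right half-line `[σ₀, ∞)` («dies at `σ₀`») has all
derivatives zero at `σ₀`.
[cite: Tao2016AveragedNS, §4 Lemma 4.1 (iii) (4.8), §6.4; cell vocabulary (`IsEternalVisc`)] -/
theorem iteratedDeriv_eq_zero_of_vanish_right (hW : IsEternalVisc ε₀ νh α W) {n : ℤ} {σ₀ : ℝ}
    (h0 : ∀ σ, σ₀ ≤ σ → W n σ = 0) (k : ℕ) : iteratedDeriv k (W n) σ₀ = 0 := by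
  -- reflect log-time: `g(σ) = W n (-σ)` is `C^∞` and vanishes on `(-∞, -σ₀]`
  have hg : ContDiff ℝ ∞ (fun σ => W n (-σ)) := (contDiff_of_isEternalVisc hW n).comp contDiff_neg
  have hg0 : ∀ σ, σ ≤ -σ₀ → W n (-σ) = 0 := fun σ hσ => h0 (-σ) (by linarith)
  have hk := iteratedDeriv_eq_zero_of_contDiff_of_vanish_left hg hg0 k
  rw [iteratedDeriv_comp_neg k (W n) (-σ₀), neg_neg] at hk
  have h1 : ((-1 : ℝ) ^ k) ≠ 0 := pow_ne_zero _ (by norm_num)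
  exact (smul_eq_zero.1 hk).resolve_left h1

/-! ## No analytic births -/

/-- A function that is analytic at `σ₀` with all derivatives zero there vanishes near `σ₀`.
[folklore (identity principle, one real variable)] -/
theorem eventually_zero_of_analyticAt_of_iteratedDeriv_eq_zero {f : ℝ → Em m} {σ₀ : ℝ}
    (hf : AnalyticAt ℝ f σ₀) (h0 : ∀ k : ℕ, iteratedDeriv k f σ₀ = 0) : f =ᶠ[𝓝 σ₀] 0 := by
  obtain ⟨p, r, hp⟩ := hf
  have hball : ∀ y : ℝ, y ∈ Metric.eball (0 : ℝ) r → f (σ₀ + y) = 0 := by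
    intro y hy
    have hsum := hp.hasSum_iteratedFDeriv hy
    have hterm : (fun k : ℕ => ((Nat.factorial k : ℝ))⁻¹ • iteratedFDeriv ℝ k f σ₀ fun _ => y)
        = fun _ => 0 := by
      funext k
      rw [iteratedFDeriv_apply_eq_iteratedDeriv_mul_prod, h0 k, smul_zero, smul_zero]
    rw [hterm] at hsum
    exact hsum.unique hasSum_zero
  have hr : 0 < r := hp.r_pos
  have hnhds : {z : ℝ | z - σ₀ ∈ Metric.eball (0 : ℝ) r} ∈ 𝓝 σ₀ := by
    have hcont : Continuous fun z : ℝ => z - σ₀ := by fun_prop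
    have hopen : IsOpen {z : ℝ | z - σ₀ ∈ Metric.eball (0 : ℝ) r} :=
      Metric.isOpen_eball.preimage hcont
    exact hopen.mem_nhds (by simp [Metric.mem_eball, hr])
  filter_upwards [hnhds] with z hz
  have := hball (z - σ₀) hz
  rwa [add_sub_cancel] at this

/-- **No analytic births.**  A shell of an admissible eternal solution that vanishes on `(-∞, σ₀]`
and is real-analytic at `σ₀` vanishes on a neighbourhood of `σ₀`.
[cite: Tao2016AveragedNS, §4 Lemma 4.1 (iii) (4.8), §6.4; cell vocabulary (`IsEternalVisc`)] -/
theorem eventually_zero_of_analyticAt_birth (hW : IsEternalVisc ε₀ νh α W) {n : ℤ} {σ₀ : ℝ}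
    (h0 : ∀ σ, σ ≤ σ₀ → W n σ = 0) (han : AnalyticAt ℝ (W n) σ₀) : W n =ᶠ[𝓝 σ₀] 0 :=
  eventually_zero_of_analyticAt_of_iteratedDeriv_eq_zero han
    (iteratedDeriv_eq_zero_of_vanish_left hW h0)

/-! ## No piecewise-analytic gluing: one-sided analytic pieces must agree -/

/-- Iterated derivatives are continuous at a point of analyticity. [folklore] -/
theorem continuousAt_iteratedDeriv_of_analyticAt {g : ℝ → Em m} {x : ℝ} (hg : AnalyticAt ℝ g x)
    (k : ℕ) : ContinuousAt (iteratedDeriv k g) x := by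
  have hS : AnalyticOnNhd ℝ g {y | AnalyticAt ℝ g y} := fun y hy => hy
  have hk := (hS.iteratedFDeriv_of_isOpen (isOpen_analyticAt ℝ g) k) x hg
  have hcont : ContinuousAt (iteratedFDeriv ℝ k g) x := hk.continuousAt
  have heq : iteratedDeriv k g = fun y => iteratedFDeriv ℝ k g y (fun _ => 1) := by
    funext y; exact iteratedDeriv_eq_iteratedFDeriv
  rw [heq]
  have hev : Continuous fun M : ContinuousMultilinearMap ℝ (fun _ : Fin k => ℝ) (Em m) =>
      M (fun _ => 1) := by
    fun_prop
  exact hev.continuousAt.comp hcont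

/-- If a `C^∞` function agrees with an analytic germ on a LEFT neighbourhood of `x`, all its
derivatives at `x` are those of the germ. [folklore] -/
theorem iteratedDeriv_eq_of_eventually_left {f g : ℝ → Em m} {x : ℝ} (hf : ContDiff ℝ ∞ f)
    (hg : AnalyticAt ℝ g x) (h : ∀ᶠ y in 𝓝[<] x, f y = g y) (k : ℕ) :
    iteratedDeriv k f x = iteratedDeriv k g x := by
  have hopen : ∀ᶠ y in 𝓝[<] x, iteratedDeriv k f y = iteratedDeriv k g y := by
    obtain ⟨a, hax, ha⟩ : ∃ a < x, ∀ y, a < y → y < x → f y = g y := by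
      rcases (mem_nhdsLT_iff_exists_Ioo_subset).1 h with ⟨a, hax, ha⟩
      exact ⟨a, hax, fun y h1 h2 => ha ⟨h1, h2⟩⟩
    filter_upwards [Ioo_mem_nhdsLT hax] with y hy
    have hev : f =ᶠ[𝓝 y] g := by
      filter_upwards [Ioo_mem_nhds hy.1 hy.2] with z hz using ha z hz.1 hz.2
    exact hev.iteratedDeriv_eq k
  have hcf : ContinuousAt (iteratedDeriv k f) x :=
    (hf.continuous_iteratedDeriv k (by exact_mod_cast le_top)).continuousAt
  have hcg : ContinuousAt (iteratedDeriv k g) x := continuousAt_iteratedDeriv_of_analyticAt hg k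
  exact tendsto_nhds_unique_of_eventuallyEq (hcf.tendsto.mono_left nhdsWithin_le_nhds)
    (hcg.tendsto.mono_left nhdsWithin_le_nhds) hopen

/-- The same on a RIGHT neighbourhood. [folklore] -/
theorem iteratedDeriv_eq_of_eventually_right {f g : ℝ → Em m} {x : ℝ} (hf : ContDiff ℝ ∞ f)
    (hg : AnalyticAt ℝ g x) (h : ∀ᶠ y in 𝓝[>] x, f y = g y) (k : ℕ) :
    iteratedDeriv k f x = iteratedDeriv k g x := by
  have hopen : ∀ᶠ y in 𝓝[>] x, iteratedDeriv k f y = iteratedDeriv k g y := by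
    obtain ⟨b, hxb, hb⟩ : ∃ b, x < b ∧ ∀ y, x < y → y < b → f y = g y := by
      rcases (mem_nhdsGT_iff_exists_Ioo_subset).1 h with ⟨b, hxb, hb⟩
      exact ⟨b, hxb, fun y h1 h2 => hb ⟨h1, h2⟩⟩
    filter_upwards [Ioo_mem_nhdsGT hxb] with y hy
    have hev : f =ᶠ[𝓝 y] g := by
      filter_upwards [Ioo_mem_nhds hy.1 hy.2] with z hz using hb z hz.1 hz.2
    exact hev.iteratedDeriv_eq k
  have hcf : ContinuousAt (iteratedDeriv k f) x :=
    (hf.continuous_iteratedDeriv k (by exact_mod_cast le_top)).continuousAt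
  have hcg : ContinuousAt (iteratedDeriv k g) x := continuousAt_iteratedDeriv_of_analyticAt hg k
  exact tendsto_nhds_unique_of_eventuallyEq (hcf.tendsto.mono_left nhdsWithin_le_nhds)
    (hcg.tendsto.mono_left nhdsWithin_le_nhds) hopen

/-- **No piecewise-analytic gluing.**  If a shell of an admissible eternal solution coincides with a
real-analytic germ `g` just before the log-time `σ₀` and with a real-analytic germ `h` just after it
(e.g. two closed-form expressions — polynomial, rational, trigonometric, exponential — on consecutive
stages of a proposed construction), then `g = h` near `σ₀` and the shell IS that single analytic germ
near `σ₀`: stage boundaries with a genuine change of formula are impossible.  (With `g = 0` this is the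
flat-birth obstruction again.)
[cite: Tao2016AveragedNS, §4 Lemma 4.1 (iii) (4.8), §6.4; cell vocabulary (`IsEternalVisc`)] -/
theorem analytic_pieces_agree (hW : IsEternalVisc ε₀ νh α W) {n : ℤ} {σ₀ : ℝ} {g h : ℝ → Em m}
    (hg : AnalyticAt ℝ g σ₀) (hh : AnalyticAt ℝ h σ₀)
    (hl : ∀ᶠ σ in 𝓝[<] σ₀, W n σ = g σ) (hr : ∀ᶠ σ in 𝓝[>] σ₀, W n σ = h σ) :
    g =ᶠ[𝓝 σ₀] h ∧ W n =ᶠ[𝓝 σ₀] g := by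
  have hsm := contDiff_of_isEternalVisc hW n
  have hderiv : ∀ k : ℕ, iteratedDeriv k g σ₀ = iteratedDeriv k h σ₀ := fun k =>
    (iteratedDeriv_eq_of_eventually_left hsm hg hl k).symm.trans
      (iteratedDeriv_eq_of_eventually_right hsm hh hr k)
  -- `g - h` is analytic at `σ₀` with all derivatives zero, hence vanishes near `σ₀`
  have hsub : ∀ k : ℕ, iteratedDeriv k (g - h) σ₀ = 0 := fun k => by
    rw [iteratedDeriv_sub hg.contDiffAt hh.contDiffAt, hderiv k, sub_self]
  have hgh : (g - h) =ᶠ[𝓝 σ₀] 0 :=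
    eventually_zero_of_analyticAt_of_iteratedDeriv_eq_zero (hg.sub hh) hsub
  have hgh' : g =ᶠ[𝓝 σ₀] h := by
    filter_upwards [hgh] with σ hσ
    have : g σ - h σ = 0 := by simpa using hσ
    exact sub_eq_zero.1 this
  refine ⟨hgh', ?_⟩
  -- the shell equals `g` on the left, `h = g` on the right, and at `σ₀` by continuity (`k = 0`)
  have h0 : W n σ₀ = g σ₀ := by
    simpa using iteratedDeriv_eq_of_eventually_left hsm hg hl 0
  have hr' : ∀ᶠ σ in 𝓝[>] σ₀, W n σ = g σ := by
    filter_upwards [hr, nhdsWithin_le_nhds hgh'] with σ h1 h2 using h1.trans h2.symm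
  have hne : ∀ᶠ σ in 𝓝[≠] σ₀, W n σ = g σ := by
    rw [← nhdsLT_sup_nhdsGT]
    exact ⟨hl, hr'⟩
  rw [Filter.EventuallyEq, ← nhdsNE_sup_pure σ₀]
  exact ⟨hne, by simpa using h0⟩

end WakeRatchetSmooth

end Summit.NavierStokesRegularity.NavierStokesRegularity.Theorems

end
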